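import Summits.QuantumFields.YangMills.Theorems.UnitScaleTiltProp7GreenOneSupRowsOfLetters
import Summits.QuantumFields.YangMills.Theorems.UnitScaleTiltProp7GreenPiBlockDecayLocal
import HarnessLib

/-!
# Route `UnitScaleTilt`, crux K1 «MinimiserStabilityRegPr» (stmt-QuantumFields-19200), EX rows `norm_H₁`∕`hCk` (J-slot) — NORM_G ROAD brick N6-J, FILE E1: **THE AGMON-WEIGHTED
# `(sup, sup∘D*)` BOOTSTRAP FOR `G₁` — BLOCK-SUPPORTED SOURCE ⟹ EXPONENTIALLY DECAYING `G₁`-VALUES AND DIVERGENCES** (the J-slot twin of ✓D2 `…GreenPiBlockDecayOfLetters`; the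
# `hGblk` letter of the H-DOOR at the slot `Δ₁ = DeltaOneP … T_J`)

Cell `ym3-torus` (HUMAN RULING D-0037; rung R3 = SU(2) YM₃ on T³ — NOT d = 4, NOT infinite volume, NOT a mass gap, NOT Clay).  Fleet lead ∕ chair seat `ym-ust-19200-p1` (gen 27).
THEOREMS ONLY (0 `def`, 0 `sorry`); `--supports stmt-QuantumFields-19200 --as helper`; count-neutral.

THE MATHEMATICS.  px17 g11's six-term identity ✓`GT_one_eq_six_terms` (`G₁f = G₀f + G₀(Δ^η(Dλ₁)) + (Dλ₂ − G₀(Δ^η(Dλ₂))) − G₀(T_J(Pᴾu)) + (Dλ₃ − G₀(Δ^η(Dλ₃)))`) read in the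
WEIGHTED sup norms of ✓D2 (`N_V = max_b e^{δ·dc(B b₋,z)}|u(b)|`, `N_D = max_x e^{δ·dc(B x,z)}|(D*u)(x)|`): the `Δ^ηD`∕`D*Δ^η` multipliers are local and `O(α)` (✓D1), the letters enter in
their weighted editions (✓D2's `hGw hDw hc1w hc2w hc3w` + two new ones for the two-block-local `T_J`: `hTw` (values, `CT`) and `hTDw` (divergences, `CTD`)), and ✓FILE C's `bootstrap_two`
closes the fixpoint in the window `2(1+e^{4δ})αC₁(BV+BD) + [(6α(1+e^{4δ}) + CTD)·C₃·(1 + C₂ + 2(1+e^{4δ})αC₁(BV+BD)) + CT(BV+BD)]·(1+C₂) ≤ ½` (= ✓p770606's window with the slack `e^{4δ}`).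

WHAT IS PROVED (ns `…Theorems.Prop7GreenOneBlockDecayOfLetters`; member `F n K`, `h : n ≤ K`, weights `c₀ cB > 0`, coupling `0 ≤ a`, rate `0 ≤ δ`, abstract slot letter `T_J`).
* ★★★★ `blockDecay_rows_GTone_of_letters` — on `RegPr α`, `PosOnto` at `Δ^η` and at `Δ₁ = DeltaOneP … T_J`, the seven weighted letters about the block `z` and the window: for every `X`
  supported on the bonds of block `z` with `‖X b‖ ≤ s`, `‖toL2⁻¹(G₁(toL2 X)) bd‖ ≤ 2(BV+BD)·s·e^{−δ·dc(B bd₋, z)}` and `‖toL2S⁻¹(D*G₁(toL2 X)) x‖ ≤ 2(BV+BD)·s·e^{−δ·dc(B x, z)}`.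
  (The H-DOOR∕block-letter editions are FILE E2.)
HONEST SCOPE.  Bookkeeping over displayed letters (suppliers: (Gw)∕(Dw) px16∕px21 via ✓D3, (c·w) px5 W4, (Tw)∕(TDw) ⟸ `T_J`'s two-block locality ✓`Prop7TJKernelLocality` + the sup rows
✓`norm_TJP_apply_le_of_columns` ∕ px19 ✓p768852); nothing of `norm_H₁`, `hCk`, `norm_G`, the 8 EX rows, `hThm2S`, EX or the crux is proved; nothing continuum ∕ Clay.

References: T. Bałaban, CMP **99** (1985) 389–434 [Balaban1985BackgroundPropagators] ((3.42) p.397, (3.128)–(3.131) pp.421–422, (3.134)–(3.138) pp.422–423, Thm 3.12 p.423).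
-/

set_option autoImplicit false

noncomputable section

open scoped Matrix.Norms.L2Operator BigOperators InnerProductSpace ComplexConjugate
open Complex (I)

namespace Summit.QuantumFields.YangMills.Theorems.Prop7GreenOneBlockDecayOfLetters

open Literature.MathematicalPhysics.QuantumFieldTheory.Balaban1983to89
open Literature.MathematicalPhysics.QuantumFieldTheory.Balaban1983to89.T3ContinuumYM3Torus
open T3PrintedRegularMinimiser (RegPr)
open T3SectALandauChart (formComp bgUnits eta eta_pos)
open B5Eq118OneStroke (iterBlockOf)
open B9TorusCalculus (torusT)
open B9Eq39Adjoint (R bondPair J)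
open B9Eq310Hermitian (norm_R_le)
open B9Eq3131Pointwise (norm_I_ad_le)
open Beta.BackgroundVertices (ad ad_apply)
open B9Eq311L2Pairing (WL2)
open B11Eq103H1Complex (SiteL2K BondL2K)
open Summit.QuantumFields.YangMills.Theorems.Prop7SectET3Transport (periodsT3)
open Summit.QuantumFields.YangMills.Theorems.Prop7SectET3HilbertLetters (W₂ toL2 toL2S QL2 DL2 DstarL2 covLapSite adjoint_DL2)
open Summit.QuantumFields.YangMills.Theorems.Prop7SectET3GaugeProjector (NS RS RS_RS)
open Summit.QuantumFields.YangMills.Theorems.Prop7SectET3WilsonHessian (DeltaEta DeltaEtaSlot DeltaEta_isSymmetric)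
open Summit.QuantumFields.YangMills.Theorems.Prop7SectET3CurvedPropagators (Qk laplaceA PosOnto GT)
open Summit.QuantumFields.YangMills.Theorems.Prop7SectET3DeltaPiPInv (GprimeP gaugeCorrP DeltaPiSlotP gaugeCorrP_apply)
open Summit.QuantumFields.YangMills.Theorems.Prop7SecondOrderDict (norm_bgUnits_le_one)
open Summit.QuantumFields.YangMills.Theorems.Prop7DeltaPiDefectPairing (inner_DL2_toL2S_DeltaEta_toL2 norm_J_one_le_of_regPr)
open Summit.QuantumFields.YangMills.Theorems.Prop7CurrentPairingPointwise (norm_apply_le_of_norm_inner_siteSingle_le norm_symm_DeltaEta_DL2_toL2S_apply_le)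
open Summit.QuantumFields.YangMills.Theorems.Prop7GreenPiSupRowsOfLetters (GT_pi_eq_four_terms covLapSite_lambda₂ bootstrap_two pointwise_of_four_terms)
open Summit.QuantumFields.YangMills.Theorems.Prop7SectET3DeltaOnePInv (DeltaOneP)
open Summit.QuantumFields.YangMills.Theorems.Prop7GreenOneSupRowsOfLetters (GT_one_eq_six_terms pointwise_of_six_terms)
open Summit.QuantumFields.YangMills.Theorems.Prop7BlockDistanceWeights (tdist_iterBlockOf_le tdist_src_tgt_le_one tdist_coarse_triangle tdist_coarse_comm sum_exp_neg_mul_tdist_coarse_le)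

open Summit.QuantumFields.YangMills.Theorems.Prop7GreenPiBlockDecayLocal (DeltaEta_DL2_decay DstarL2_DeltaEta_decay)
variable {F : T3Family} {n K : ℕ} {h : n ≤ K} {c₀ cB a : ℝ}
  (TJ : GaugeField (F.P K) 0 (Matrix.specialUnitaryGroup (Fin 2) ℂ) → (BondL2K ℂ 3 (periodsT3 F K) c₀ W₂ →ₗ[ℂ] BondL2K ℂ 3 (periodsT3 F K) c₀ W₂))

section Bootstrap

variable [Fact (0 < c₀)] [Fact (0 < cB)]

set_option maxHeartbeats 400000 in -- HEARTBEAT BUDGET rule (README l.50): twelve readers + two weighted maximisers in one decl (✓D2's pattern carries the same line)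
/-- ★★★★ **THE J-SLOT `hGblk` LETTER + DIVERGENCE TWIN, FROM WEIGHTED LETTERS** (J-slot twin of ✓`blockDecay_rows_GTpi_of_letters`): at `U₀ ∈ RegPr α`, on the class at `Δ^η` and
`Δ₁ = DeltaOneP … T_J`, `0 ≤ a`, rate `0 ≤ δ`, block `z`, given the weighted letters (Gw)(Dw)(c1w)(c2w)(c3w) of ✓D2 and (Tw)(TDw) for `T_J`, and the window: for every `X` supported on the
bonds of block `z` with `‖X b‖ ≤ s`, `‖toL2⁻¹(G₁(toL2 X)) bd‖ ≤ 2(BV+BD)·s·e^{−δ·dc(B bd₋, z)}` and `‖toL2S⁻¹(D*G₁(toL2 X)) x‖ ≤ 2(BV+BD)·s·e^{−δ·dc(B x, z)}`.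
[cite: Balaban1985BackgroundPropagators, (3.42) p.397, (3.128)–(3.131) pp.421–422, (3.134)–(3.138) pp.422–423, Thm 3.12 p.423] -/
theorem blockDecay_rows_GTone_of_letters {α δ : ℝ} (hδ : 0 ≤ δ) (U₀ : GaugeField (F.P K) 0 (Matrix.specialUnitaryGroup (Fin 2) ℂ)) (hreg : RegPr F n K α U₀) (ha : 0 ≤ a)
    (hp₀ : PosOnto F n K h c₀ cB a (DeltaEtaSlot F n K c₀) U₀) (hp₁ : PosOnto F n K h c₀ cB a (DeltaOneP F n K h c₀ cB a TJ) U₀)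
    (z : Site (F.P K) (K - n)) {BV BD C₁ C₂ C₃ CT CTD : ℝ} (hBV : 0 ≤ BV) (hBD : 0 ≤ BD) (hC₁ : 0 ≤ C₁) (hC₂ : 0 ≤ C₂) (hC₃ : 0 ≤ C₃) (hCT : 0 ≤ CT) (hCTD : 0 ≤ CTD)
    (hGw : ∀ (Y : PBond (F.P K) 0 → Matrix (Fin 2) (Fin 2) ℂ) (m : ℝ), 0 ≤ m →
      (∀ b, ‖Y b‖ ≤ m * Real.exp (-(δ * (Site.tdist (iterBlockOf (K - n) b.src) z : ℝ)))) →
      ∀ bd, ‖(toL2 F K c₀).symm (GT F n K h c₀ cB a (DeltaEtaSlot F n K c₀) U₀ (toL2 F K c₀ Y)) bd‖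
        ≤ BV * m * Real.exp (-(δ * (Site.tdist (iterBlockOf (K - n) bd.src) z : ℝ))))
    (hDw : ∀ (Y : PBond (F.P K) 0 → Matrix (Fin 2) (Fin 2) ℂ) (m : ℝ), 0 ≤ m →
      (∀ b, ‖Y b‖ ≤ m * Real.exp (-(δ * (Site.tdist (iterBlockOf (K - n) b.src) z : ℝ)))) →
      ∀ x, ‖(toL2S F K c₀).symm (DstarL2 F n K c₀ U₀ (GT F n K h c₀ cB a (DeltaEtaSlot F n K c₀) U₀ (toL2 F K c₀ Y))) x‖
        ≤ BD * m * Real.exp (-(δ * (Site.tdist (iterBlockOf (K - n) x) z : ℝ))))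
    (hc1w : ∀ (v : Site (F.P K) 0 → Matrix (Fin 2) (Fin 2) ℂ) (m : ℝ), 0 ≤ m →
      (∀ y, ‖v y‖ ≤ m * Real.exp (-(δ * (Site.tdist (iterBlockOf (K - n) y) z : ℝ)))) →
      ∀ y, ‖(toL2S F K c₀).symm (GprimeP F n K h c₀ cB a U₀ (RS F n K h c₀ cB U₀ (toL2S F K c₀ v))) y‖
        ≤ C₁ * m * Real.exp (-(δ * (Site.tdist (iterBlockOf (K - n) y) z : ℝ))))
    (hc2w : ∀ (v : Site (F.P K) 0 → Matrix (Fin 2) (Fin 2) ℂ) (m : ℝ), 0 ≤ m →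
      (∀ y, ‖v y‖ ≤ m * Real.exp (-(δ * (Site.tdist (iterBlockOf (K - n) y) z : ℝ)))) →
      ∀ b, ‖(toL2 F K c₀).symm (DL2 F n K c₀ U₀ (GprimeP F n K h c₀ cB a U₀ (RS F n K h c₀ cB U₀ (toL2S F K c₀ v)))) b‖
        ≤ C₂ * m * Real.exp (-(δ * (Site.tdist (iterBlockOf (K - n) b.src) z : ℝ))))
    (hc3w : ∀ (v : Site (F.P K) 0 → Matrix (Fin 2) (Fin 2) ℂ) (m : ℝ), 0 ≤ m →
      (∀ y, ‖v y‖ ≤ m * Real.exp (-(δ * (Site.tdist (iterBlockOf (K - n) y) z : ℝ)))) →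
      ∀ y, ‖(toL2S F K c₀).symm (RS F n K h c₀ cB U₀ (GprimeP F n K h c₀ cB a U₀ (toL2S F K c₀ v))) y‖
        ≤ C₃ * m * Real.exp (-(δ * (Site.tdist (iterBlockOf (K - n) y) z : ℝ))))
    (hTw : ∀ (Y : PBond (F.P K) 0 → Matrix (Fin 2) (Fin 2) ℂ) (m : ℝ), 0 ≤ m →
      (∀ b, ‖Y b‖ ≤ m * Real.exp (-(δ * (Site.tdist (iterBlockOf (K - n) b.src) z : ℝ)))) →
      ∀ bd, ‖(toL2 F K c₀).symm (TJ U₀ (toL2 F K c₀ Y)) bd‖ ≤ CT * m * Real.exp (-(δ * (Site.tdist (iterBlockOf (K - n) bd.src) z : ℝ))))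
    (hTDw : ∀ (Y : PBond (F.P K) 0 → Matrix (Fin 2) (Fin 2) ℂ) (m : ℝ), 0 ≤ m →
      (∀ b, ‖Y b‖ ≤ m * Real.exp (-(δ * (Site.tdist (iterBlockOf (K - n) b.src) z : ℝ)))) →
      ∀ x, ‖(toL2S F K c₀).symm (DstarL2 F n K c₀ U₀ (TJ U₀ (toL2 F K c₀ Y))) x‖ ≤ CTD * m * Real.exp (-(δ * (Site.tdist (iterBlockOf (K - n) x) z : ℝ))))
    (hwin : 2 * (1 + Real.exp (4 * δ)) * α * C₁ * (BV + BD)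
      + ((6 * α * (1 + Real.exp (4 * δ)) + CTD) * C₃ * (1 + C₂ + 2 * (1 + Real.exp (4 * δ)) * α * C₁ * (BV + BD)) + CT * (BV + BD)) * (1 + C₂) ≤ 1 / 2)
    (X : PBond (F.P K) 0 → Matrix (Fin 2) (Fin 2) ℂ) (hXz : ∀ b, X b ≠ 0 → iterBlockOf (K - n) b.src = z) {s : ℝ} (hs : 0 ≤ s) (hX : ∀ b, ‖X b‖ ≤ s) :
    (∀ bd, ‖(toL2 F K c₀).symm (GT F n K h c₀ cB a (DeltaOneP F n K h c₀ cB a TJ) U₀ (toL2 F K c₀ X)) bd‖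
        ≤ 2 * (BV + BD) * s * Real.exp (-(δ * (Site.tdist (iterBlockOf (K - n) bd.src) z : ℝ)))) ∧
    (∀ x, ‖(toL2S F K c₀).symm (DstarL2 F n K c₀ U₀ (GT F n K h c₀ cB a (DeltaOneP F n K h c₀ cB a TJ) U₀ (toL2 F K c₀ X))) x‖
        ≤ 2 * (BV + BD) * s * Real.exp (-(δ * (Site.tdist (iterBlockOf (K - n) x) z : ℝ)))) := by
  classical
  have hη : 0 < eta F n K := eta_pos F n K
  have hα : 0 ≤ α := by
    have hJ := norm_J_one_le_of_regPr U₀ hreg 0 (Classical.arbitrary _)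
    have h0 : 0 * eta F n K ^ 3 ≤ α * eta F n K ^ 3 := by rw [zero_mul]; exact (norm_nonneg _).trans hJ
    exact le_of_mul_le_mul_right h0 (pow_pos hη 3)
  have hE4 : 0 ≤ 1 + Real.exp (4 * δ) := by positivity
  -- opaque Agmon weights `w(b) = e^{+δ·dc(B b₋, z)}`, `w(y) = e^{+δ·dc(B y, z)}`
  obtain ⟨wB, hwBd⟩ : ∃ w : PBond (F.P K) 0 → ℝ, ∀ b, w b = Real.exp (δ * (Site.tdist (iterBlockOf (K - n) b.src) z : ℝ)) := ⟨_, fun _ => rfl⟩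
  obtain ⟨wS, hwSd⟩ : ∃ w : Site (F.P K) 0 → ℝ, ∀ y, w y = Real.exp (δ * (Site.tdist (iterBlockOf (K - n) y) z : ℝ)) := ⟨_, fun _ => rfl⟩
  have hwB : ∀ b, wB b * Real.exp (-(δ * (Site.tdist (iterBlockOf (K - n) b.src) z : ℝ))) = 1 := fun b => by
    rw [hwBd, ← Real.exp_add, add_neg_cancel, Real.exp_zero]
  have hwS : ∀ y, wS y * Real.exp (-(δ * (Site.tdist (iterBlockOf (K - n) y) z : ℝ))) = 1 := fun y => by
    rw [hwSd, ← Real.exp_add, add_neg_cancel, Real.exp_zero]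
  have hwBpos : ∀ b, 0 < wB b := fun b => by rw [hwBd]; exact Real.exp_pos _
  have hwSpos : ∀ y, 0 < wS y := fun y => by rw [hwSd]; exact Real.exp_pos _
  -- from a weighted max to the decay form
  have decayB : ∀ (U : PBond (F.P K) 0 → Matrix (Fin 2) (Fin 2) ℂ) (M : ℝ), (∀ b, wB b * ‖U b‖ ≤ M) →
      ∀ b, ‖U b‖ ≤ M * Real.exp (-(δ * (Site.tdist (iterBlockOf (K - n) b.src) z : ℝ))) := by
    intro U M hM b
    calc ‖U b‖ = (wB b * ‖U b‖) * Real.exp (-(δ * (Site.tdist (iterBlockOf (K - n) b.src) z : ℝ))) := by rw [mul_comm (wB b), mul_assoc, hwB b, mul_one]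
      _ ≤ M * Real.exp (-(δ * (Site.tdist (iterBlockOf (K - n) b.src) z : ℝ))) := mul_le_mul_of_nonneg_right (hM b) (Real.exp_pos _).le
  have decayS : ∀ (W : Site (F.P K) 0 → Matrix (Fin 2) (Fin 2) ℂ) (M : ℝ), (∀ y, wS y * ‖W y‖ ≤ M) →
      ∀ y, ‖W y‖ ≤ M * Real.exp (-(δ * (Site.tdist (iterBlockOf (K - n) y) z : ℝ))) := by
    intro W M hM y
    calc ‖W y‖ = (wS y * ‖W y‖) * Real.exp (-(δ * (Site.tdist (iterBlockOf (K - n) y) z : ℝ))) := by rw [mul_comm (wS y), mul_assoc, hwS y, mul_one]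
      _ ≤ M * Real.exp (-(δ * (Site.tdist (iterBlockOf (K - n) y) z : ℝ))) := mul_le_mul_of_nonneg_right (hM y) (Real.exp_pos _).le
  -- the four-term identity and the objects
  have h4 := GT_one_eq_six_terms TJ (h := h) (cB := cB) ha hp₀ hp₁ (toL2 F K c₀ X)
  set f := toL2 F K c₀ X with hf
  set u := GT F n K h c₀ cB a (DeltaOneP F n K h c₀ cB a TJ) U₀ f with hu
  set lam₁ := GprimeP F n K h c₀ cB a U₀ (RS F n K h c₀ cB U₀ (DstarL2 F n K c₀ U₀ u)) with hlam₁
  set j := DstarL2 F n K c₀ U₀ (DeltaEta F n K c₀ U₀ (gaugeCorrP F n K h c₀ cB a U₀ u)) with hj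
  set lam₂ := GprimeP F n K h c₀ cB a U₀ (RS F n K h c₀ cB U₀ (GprimeP F n K h c₀ cB a U₀ j)) with hlam₂
  set j₃ := DstarL2 F n K c₀ U₀ (TJ U₀ (gaugeCorrP F n K h c₀ cB a U₀ u)) with hj₃
  set lam₃ := GprimeP F n K h c₀ cB a U₀ (RS F n K h c₀ cB U₀ (GprimeP F n K h c₀ cB a U₀ j₃)) with hlam₃
  set G₀ := GT F n K h c₀ cB a (DeltaEtaSlot F n K c₀) U₀ with hG₀
  set V : Site (F.P K) 0 → Matrix (Fin 2) (Fin 2) ℂ := (toL2S F K c₀).symm (DstarL2 F n K c₀ U₀ u) with hVd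
  -- weighted maximisers (opaque scalars `NV`, `ND`)
  haveI : Nonempty (PBond (F.P K) 0) := ⟨⟨Classical.arbitrary _, 0⟩⟩
  obtain ⟨b₀, -, hb₀⟩ := Finset.exists_max_image Finset.univ (fun b => wB b * ‖(toL2 F K c₀).symm u b‖) Finset.univ_nonempty
  obtain ⟨x₀, -, hx₀⟩ := Finset.exists_max_image Finset.univ (fun y => wS y * ‖V y‖) Finset.univ_nonempty
  obtain ⟨NV, hNVd⟩ : ∃ t : ℝ, t = wB b₀ * ‖(toL2 F K c₀).symm u b₀‖ := ⟨_, rfl⟩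
  obtain ⟨ND, hNDd⟩ : ∃ t : ℝ, t = wS x₀ * ‖V x₀‖ := ⟨_, rfl⟩
  have hNV0 : 0 ≤ NV := by rw [hNVd]; exact mul_nonneg (hwBpos b₀).le (norm_nonneg _)
  have hND0 : 0 ≤ ND := by rw [hNDd]; exact mul_nonneg (hwSpos x₀).le (norm_nonneg _)
  have hUb : ∀ b, ‖(toL2 F K c₀).symm u b‖ ≤ NV * Real.exp (-(δ * (Site.tdist (iterBlockOf (K - n) b.src) z : ℝ))) :=
    decayB _ NV (fun b => by rw [hNVd]; exact hb₀ b (Finset.mem_univ b))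
  have hVx : ∀ y, ‖V y‖ ≤ ND * Real.exp (-(δ * (Site.tdist (iterBlockOf (K - n) y) z : ℝ))) :=
    decayS _ ND (fun y => by rw [hNDd]; exact hx₀ y (Finset.mem_univ y))
  -- (c1w)(c2w) on `λ₁`
  have hVeq : toL2S F K c₀ V = DstarL2 F n K c₀ U₀ u := LinearEquiv.apply_symm_apply _ _
  have hlam₁V : lam₁ = GprimeP F n K h c₀ cB a U₀ (RS F n K h c₀ cB U₀ (toL2S F K c₀ V)) := by rw [hVeq]
  have hl₁ : ∀ y, ‖(toL2S F K c₀).symm lam₁ y‖ ≤ C₁ * ND * Real.exp (-(δ * (Site.tdist (iterBlockOf (K - n) y) z : ℝ))) := fun y => by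
    rw [hlam₁V]; exact hc1w V ND hND0 hVx y
  have hDl₁ : ∀ b, ‖(toL2 F K c₀).symm (DL2 F n K c₀ U₀ lam₁) b‖ ≤ C₂ * ND * Real.exp (-(δ * (Site.tdist (iterBlockOf (K - n) b.src) z : ℝ))) := fun b => by
    rw [hlam₁V]; exact hc2w V ND hND0 hVx b
  -- `Pᴾu = u − Dλ₁`
  set Pu : PBond (F.P K) 0 → Matrix (Fin 2) (Fin 2) ℂ := (toL2 F K c₀).symm (gaugeCorrP F n K h c₀ cB a U₀ u) with hPu
  have hPu_le : ∀ b, ‖Pu b‖ ≤ (NV + C₂ * ND) * Real.exp (-(δ * (Site.tdist (iterBlockOf (K - n) b.src) z : ℝ))) := by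
    intro b
    have e : Pu b = (toL2 F K c₀).symm u b - (toL2 F K c₀).symm (DL2 F n K c₀ U₀ lam₁) b := by
      rw [hPu, gaugeCorrP_apply, map_sub, Pi.sub_apply]
    rw [e, add_mul]
    exact (norm_sub_le _ _).trans (add_le_add (hUb b) (hDl₁ b))
  -- (C-div) decayed on `j = D*Δ^η(Pᴾu)`
  have hPueq : toL2 F K c₀ Pu = gaugeCorrP F n K h c₀ cB a U₀ u := LinearEquiv.apply_symm_apply _ _
  have hP0 : 0 ≤ NV + C₂ * ND := by positivity
  have hjle : ∀ y, ‖(toL2S F K c₀).symm j y‖ ≤ 6 * α * (1 + Real.exp (4 * δ)) * (NV + C₂ * ND) * Real.exp (-(δ * (Site.tdist (iterBlockOf (K - n) y) z : ℝ))) := by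
    intro y
    rw [hj, ← hPueq]
    exact DstarL2_DeltaEta_decay hδ U₀ hreg Pu z hP0 hPu_le y
  have hJ0 : 0 ≤ 6 * α * (1 + Real.exp (4 * δ)) * (NV + C₂ * ND) := by positivity
  -- (c3w) on `g₂ = R_S(G′ᴾ j)`, then (c1w)(c2w) on `λ₂`
  set Jv : Site (F.P K) 0 → Matrix (Fin 2) (Fin 2) ℂ := (toL2S F K c₀).symm j with hJv
  have hJveq : toL2S F K c₀ Jv = j := LinearEquiv.apply_symm_apply _ _
  set g₂ := RS F n K h c₀ cB U₀ (GprimeP F n K h c₀ cB a U₀ j) with hg₂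
  have hg₂le : ∀ y, ‖(toL2S F K c₀).symm g₂ y‖ ≤ C₃ * (6 * α * (1 + Real.exp (4 * δ)) * (NV + C₂ * ND)) * Real.exp (-(δ * (Site.tdist (iterBlockOf (K - n) y) z : ℝ))) :=
    fun y => by rw [hg₂, ← hJveq]; exact hc3w Jv _ hJ0 hjle y
  have hG20 : 0 ≤ C₃ * (6 * α * (1 + Real.exp (4 * δ)) * (NV + C₂ * ND)) := by positivity
  set Gv : Site (F.P K) 0 → Matrix (Fin 2) (Fin 2) ℂ := (toL2S F K c₀).symm g₂ with hGv
  have hGveq : toL2S F K c₀ Gv = g₂ := LinearEquiv.apply_symm_apply _ _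
  have hlam₂G : lam₂ = GprimeP F n K h c₀ cB a U₀ (RS F n K h c₀ cB U₀ (toL2S F K c₀ Gv)) := by rw [hGveq, hg₂, RS_RS]
  have hl₂ : ∀ y, ‖(toL2S F K c₀).symm lam₂ y‖ ≤ C₁ * (C₃ * (6 * α * (1 + Real.exp (4 * δ)) * (NV + C₂ * ND))) * Real.exp (-(δ * (Site.tdist (iterBlockOf (K - n) y) z : ℝ))) :=
    fun y => by rw [hlam₂G]; exact hc1w Gv _ hG20 hg₂le y
  have hDl₂ : ∀ b, ‖(toL2 F K c₀).symm (DL2 F n K c₀ U₀ lam₂) b‖ ≤ C₂ * (C₃ * (6 * α * (1 + Real.exp (4 * δ)) * (NV + C₂ * ND))) * Real.exp (-(δ * (Site.tdist (iterBlockOf (K - n) b.src) z : ℝ))) :=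
    fun b => by rw [hlam₂G]; exact hc2w Gv _ hG20 hg₂le b
  -- (C-val) decayed on the two defect sources
  have hsrc : ∀ (lam : SiteL2K ℂ 3 (periodsT3 F K) c₀ W₂) (m : ℝ), 0 ≤ m →
      (∀ y, ‖(toL2S F K c₀).symm lam y‖ ≤ m * Real.exp (-(δ * (Site.tdist (iterBlockOf (K - n) y) z : ℝ)))) →
      ∀ b, ‖(toL2 F K c₀).symm (DeltaEta F n K c₀ U₀ (DL2 F n K c₀ U₀ lam)) b‖ ≤ 2 * α * (1 + Real.exp (4 * δ)) * m * Real.exp (-(δ * (Site.tdist (iterBlockOf (K - n) b.src) z : ℝ))) := by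
    intro lam m hm0 hm b
    have e : lam = toL2S F K c₀ ((toL2S F K c₀).symm lam) := (LinearEquiv.apply_symm_apply _ _).symm
    rw [e]
    exact DeltaEta_DL2_decay hδ U₀ hreg _ z hm0 hm b
  have hS₁ := hsrc lam₁ (C₁ * ND) (by positivity) hl₁
  have hS₂ := hsrc lam₂ (C₁ * (C₃ * (6 * α * (1 + Real.exp (4 * δ)) * (NV + C₂ * ND)))) (by positivity) hl₂
  -- the `G₀` rows on the three decaying sources
  have hread : ∀ y : BondL2K ℂ 3 (periodsT3 F K) c₀ W₂, y = toL2 F K c₀ ((toL2 F K c₀).symm y) := fun y => (LinearEquiv.apply_symm_apply _ _).symm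
  have hXw : ∀ b, ‖X b‖ ≤ s * Real.exp (-(δ * (Site.tdist (iterBlockOf (K - n) b.src) z : ℝ))) := by
    intro b
    by_cases hb : X b = 0
    · rw [hb, norm_zero]; positivity
    · have h0 : (Site.tdist z z : ℝ) = 0 := by exact_mod_cast (by simp [Site.tdist] : Site.tdist z z = 0)
      rw [hXz b hb, h0, mul_zero, neg_zero, Real.exp_zero, mul_one]; exact hX b
  have hV₀ := hGw X s hs hXw
  have hV₁ : ∀ b, ‖(toL2 F K c₀).symm (G₀ (DeltaEta F n K c₀ U₀ (DL2 F n K c₀ U₀ lam₁))) b‖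
      ≤ BV * (2 * α * (1 + Real.exp (4 * δ)) * (C₁ * ND)) * Real.exp (-(δ * (Site.tdist (iterBlockOf (K - n) b.src) z : ℝ))) := fun b => by
    rw [hread (DeltaEta F n K c₀ U₀ (DL2 F n K c₀ U₀ lam₁))]; exact hGw _ _ (by positivity) hS₁ b
  have hV₂ : ∀ b, ‖(toL2 F K c₀).symm (G₀ (DeltaEta F n K c₀ U₀ (DL2 F n K c₀ U₀ lam₂))) b‖
      ≤ BV * (2 * α * (1 + Real.exp (4 * δ)) * (C₁ * (C₃ * (6 * α * (1 + Real.exp (4 * δ)) * (NV + C₂ * ND))))) * Real.exp (-(δ * (Site.tdist (iterBlockOf (K - n) b.src) z : ℝ))) :=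
    fun b => by rw [hread (DeltaEta F n K c₀ U₀ (DL2 F n K c₀ U₀ lam₂))]; exact hGw _ _ (by positivity) hS₂ b
  have hD₀ := hDw X s hs hXw
  have hD₁ : ∀ y, ‖(toL2S F K c₀).symm (DstarL2 F n K c₀ U₀ (G₀ (DeltaEta F n K c₀ U₀ (DL2 F n K c₀ U₀ lam₁)))) y‖
      ≤ BD * (2 * α * (1 + Real.exp (4 * δ)) * (C₁ * ND)) * Real.exp (-(δ * (Site.tdist (iterBlockOf (K - n) y) z : ℝ))) := fun y => by
    rw [hread (DeltaEta F n K c₀ U₀ (DL2 F n K c₀ U₀ lam₁))]; exact hDw _ _ (by positivity) hS₁ y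
  have hD₂ : ∀ y, ‖(toL2S F K c₀).symm (DstarL2 F n K c₀ U₀ (G₀ (DeltaEta F n K c₀ U₀ (DL2 F n K c₀ U₀ lam₂)))) y‖
      ≤ BD * (2 * α * (1 + Real.exp (4 * δ)) * (C₁ * (C₃ * (6 * α * (1 + Real.exp (4 * δ)) * (NV + C₂ * ND))))) * Real.exp (-(δ * (Site.tdist (iterBlockOf (K - n) y) z : ℝ))) :=
    fun y => by rw [hread (DeltaEta F n K c₀ U₀ (DL2 F n K c₀ U₀ lam₂))]; exact hDw _ _ (by positivity) hS₂ y
  have hDDl₂ : ∀ y, ‖(toL2S F K c₀).symm (DstarL2 F n K c₀ U₀ (DL2 F n K c₀ U₀ lam₂)) y‖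
      ≤ C₃ * (6 * α * (1 + Real.exp (4 * δ)) * (NV + C₂ * ND)) * Real.exp (-(δ * (Site.tdist (iterBlockOf (K - n) y) z : ℝ))) := fun y => by
    rw [hlam₂, covLapSite_lambda₂ (h := h) (cB := cB) ha U₀ j]; exact hg₂le y
  -- the `T_J` word: `B = T_J(Pᴾu)`, `j₃ = D*B`, `g₃ = R_S(G′ᴾ j₃)`, `λ₃ = G′ᴾR_S g₃`
  have hB : ∀ b, ‖(toL2 F K c₀).symm (TJ U₀ (gaugeCorrP F n K h c₀ cB a U₀ u)) b‖ ≤ CT * (NV + C₂ * ND) * Real.exp (-(δ * (Site.tdist (iterBlockOf (K - n) b.src) z : ℝ))) := fun b => by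
    rw [← hPueq]; exact hTw Pu _ hP0 hPu_le b
  have hj₃le : ∀ y, ‖(toL2S F K c₀).symm j₃ y‖ ≤ CTD * (NV + C₂ * ND) * Real.exp (-(δ * (Site.tdist (iterBlockOf (K - n) y) z : ℝ))) := fun y => by
    rw [hj₃, ← hPueq]; exact hTDw Pu _ hP0 hPu_le y
  have hJ30 : 0 ≤ CTD * (NV + C₂ * ND) := by positivity
  set Jv₃ : Site (F.P K) 0 → Matrix (Fin 2) (Fin 2) ℂ := (toL2S F K c₀).symm j₃ with hJv₃
  have hJv₃eq : toL2S F K c₀ Jv₃ = j₃ := LinearEquiv.apply_symm_apply _ _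
  set g₃ := RS F n K h c₀ cB U₀ (GprimeP F n K h c₀ cB a U₀ j₃) with hg₃
  have hg₃le : ∀ y, ‖(toL2S F K c₀).symm g₃ y‖ ≤ C₃ * (CTD * (NV + C₂ * ND)) * Real.exp (-(δ * (Site.tdist (iterBlockOf (K - n) y) z : ℝ))) :=
    fun y => by rw [hg₃, ← hJv₃eq]; exact hc3w Jv₃ _ hJ30 hj₃le y
  have hG30 : 0 ≤ C₃ * (CTD * (NV + C₂ * ND)) := by positivity
  set Gv₃ : Site (F.P K) 0 → Matrix (Fin 2) (Fin 2) ℂ := (toL2S F K c₀).symm g₃ with hGv₃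
  have hGv₃eq : toL2S F K c₀ Gv₃ = g₃ := LinearEquiv.apply_symm_apply _ _
  have hlam₃G : lam₃ = GprimeP F n K h c₀ cB a U₀ (RS F n K h c₀ cB U₀ (toL2S F K c₀ Gv₃)) := by rw [hGv₃eq, hg₃, RS_RS]
  have hl₃ : ∀ y, ‖(toL2S F K c₀).symm lam₃ y‖ ≤ C₁ * (C₃ * (CTD * (NV + C₂ * ND))) * Real.exp (-(δ * (Site.tdist (iterBlockOf (K - n) y) z : ℝ))) :=
    fun y => by rw [hlam₃G]; exact hc1w Gv₃ _ hG30 hg₃le y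
  have hDl₃ : ∀ b, ‖(toL2 F K c₀).symm (DL2 F n K c₀ U₀ lam₃) b‖ ≤ C₂ * (C₃ * (CTD * (NV + C₂ * ND))) * Real.exp (-(δ * (Site.tdist (iterBlockOf (K - n) b.src) z : ℝ))) :=
    fun b => by rw [hlam₃G]; exact hc2w Gv₃ _ hG30 hg₃le b
  have hS₃ := hsrc lam₃ (C₁ * (C₃ * (CTD * (NV + C₂ * ND)))) (by positivity) hl₃
  have hVB : ∀ b, ‖(toL2 F K c₀).symm (G₀ (TJ U₀ (gaugeCorrP F n K h c₀ cB a U₀ u))) b‖ ≤ BV * (CT * (NV + C₂ * ND)) * Real.exp (-(δ * (Site.tdist (iterBlockOf (K - n) b.src) z : ℝ))) := fun b => by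
    rw [hread (TJ U₀ (gaugeCorrP F n K h c₀ cB a U₀ u))]; exact hGw _ _ (by positivity) hB b
  have hDB : ∀ y, ‖(toL2S F K c₀).symm (DstarL2 F n K c₀ U₀ (G₀ (TJ U₀ (gaugeCorrP F n K h c₀ cB a U₀ u)))) y‖ ≤ BD * (CT * (NV + C₂ * ND)) * Real.exp (-(δ * (Site.tdist (iterBlockOf (K - n) y) z : ℝ))) := fun y => by
    rw [hread (TJ U₀ (gaugeCorrP F n K h c₀ cB a U₀ u))]; exact hDw _ _ (by positivity) hB y
  have hV₃ : ∀ b, ‖(toL2 F K c₀).symm (G₀ (DeltaEta F n K c₀ U₀ (DL2 F n K c₀ U₀ lam₃))) b‖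
      ≤ BV * (2 * α * (1 + Real.exp (4 * δ)) * (C₁ * (C₃ * (CTD * (NV + C₂ * ND))))) * Real.exp (-(δ * (Site.tdist (iterBlockOf (K - n) b.src) z : ℝ))) := fun b => by
    rw [hread (DeltaEta F n K c₀ U₀ (DL2 F n K c₀ U₀ lam₃))]; exact hGw _ _ (by positivity) hS₃ b
  have hD₃ : ∀ y, ‖(toL2S F K c₀).symm (DstarL2 F n K c₀ U₀ (G₀ (DeltaEta F n K c₀ U₀ (DL2 F n K c₀ U₀ lam₃)))) y‖
      ≤ BD * (2 * α * (1 + Real.exp (4 * δ)) * (C₁ * (C₃ * (CTD * (NV + C₂ * ND))))) * Real.exp (-(δ * (Site.tdist (iterBlockOf (K - n) y) z : ℝ))) := fun y => by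
    rw [hread (DeltaEta F n K c₀ U₀ (DL2 F n K c₀ U₀ lam₃))]; exact hDw _ _ (by positivity) hS₃ y
  have hDDl₃ : ∀ y, ‖(toL2S F K c₀).symm (DstarL2 F n K c₀ U₀ (DL2 F n K c₀ U₀ lam₃)) y‖ ≤ C₃ * (CTD * (NV + C₂ * ND)) * Real.exp (-(δ * (Site.tdist (iterBlockOf (K - n) y) z : ℝ))) := fun y => by
    rw [hlam₃, covLapSite_lambda₂ (h := h) (cB := cB) ha U₀ j₃]; exact hg₃le y
  -- pointwise assembly at the maximisers (FILE C's abstract lemma), then the weights are removed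
  have hasm := pointwise_of_six_terms (n := n) G₀ U₀ u f _ _ _ _ _ _ h4 b₀ x₀ (hV₀ b₀) (hV₁ b₀) (hDl₂ b₀) (hV₂ b₀) (hVB b₀) (hDl₃ b₀) (hV₃ b₀)
    (hD₀ x₀) (hD₁ x₀) (hDDl₂ x₀) (hD₂ x₀) (hDB x₀) (hDDl₃ x₀) (hD₃ x₀)
  have hEB1 : wB b₀ * Real.exp (-(δ * (Site.tdist (iterBlockOf (K - n) b₀.src) z : ℝ))) = 1 := hwB b₀
  have hES1 : wS x₀ * Real.exp (-(δ * (Site.tdist (iterBlockOf (K - n) x₀) z : ℝ))) = 1 := hwS x₀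
  have hNVle : NV ≤ BV * s + BV * (2 * α * (1 + Real.exp (4 * δ)) * (C₁ * ND))
      + (C₂ * (C₃ * (6 * α * (1 + Real.exp (4 * δ)) * (NV + C₂ * ND))) + BV * (2 * α * (1 + Real.exp (4 * δ)) * (C₁ * (C₃ * (6 * α * (1 + Real.exp (4 * δ)) * (NV + C₂ * ND))))))
      + BV * (CT * (NV + C₂ * ND)) + (C₂ * (C₃ * (CTD * (NV + C₂ * ND))) + BV * (2 * α * (1 + Real.exp (4 * δ)) * (C₁ * (C₃ * (CTD * (NV + C₂ * ND)))))) := by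
    have e1 : ‖(toL2 F K c₀).symm u b₀‖ ≤ (BV * s + BV * (2 * α * (1 + Real.exp (4 * δ)) * (C₁ * ND))
        + (C₂ * (C₃ * (6 * α * (1 + Real.exp (4 * δ)) * (NV + C₂ * ND))) + BV * (2 * α * (1 + Real.exp (4 * δ)) * (C₁ * (C₃ * (6 * α * (1 + Real.exp (4 * δ)) * (NV + C₂ * ND))))))
        + BV * (CT * (NV + C₂ * ND)) + (C₂ * (C₃ * (CTD * (NV + C₂ * ND))) + BV * (2 * α * (1 + Real.exp (4 * δ)) * (C₁ * (C₃ * (CTD * (NV + C₂ * ND)))))))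
          * Real.exp (-(δ * (Site.tdist (iterBlockOf (K - n) b₀.src) z : ℝ))) :=
      hasm.1.trans (le_of_eq (by ring))
    calc NV = wB b₀ * ‖(toL2 F K c₀).symm u b₀‖ := hNVd
      _ ≤ wB b₀ * ((BV * s + BV * (2 * α * (1 + Real.exp (4 * δ)) * (C₁ * ND))
        + (C₂ * (C₃ * (6 * α * (1 + Real.exp (4 * δ)) * (NV + C₂ * ND))) + BV * (2 * α * (1 + Real.exp (4 * δ)) * (C₁ * (C₃ * (6 * α * (1 + Real.exp (4 * δ)) * (NV + C₂ * ND))))))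
        + BV * (CT * (NV + C₂ * ND)) + (C₂ * (C₃ * (CTD * (NV + C₂ * ND))) + BV * (2 * α * (1 + Real.exp (4 * δ)) * (C₁ * (C₃ * (CTD * (NV + C₂ * ND)))))))
          * Real.exp (-(δ * (Site.tdist (iterBlockOf (K - n) b₀.src) z : ℝ)))) := mul_le_mul_of_nonneg_left e1 (hwBpos b₀).le
      _ = (BV * s + BV * (2 * α * (1 + Real.exp (4 * δ)) * (C₁ * ND))
        + (C₂ * (C₃ * (6 * α * (1 + Real.exp (4 * δ)) * (NV + C₂ * ND))) + BV * (2 * α * (1 + Real.exp (4 * δ)) * (C₁ * (C₃ * (6 * α * (1 + Real.exp (4 * δ)) * (NV + C₂ * ND))))))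
        + BV * (CT * (NV + C₂ * ND)) + (C₂ * (C₃ * (CTD * (NV + C₂ * ND))) + BV * (2 * α * (1 + Real.exp (4 * δ)) * (C₁ * (C₃ * (CTD * (NV + C₂ * ND)))))))
          * (wB b₀ * Real.exp (-(δ * (Site.tdist (iterBlockOf (K - n) b₀.src) z : ℝ)))) := by ring
      _ = _ := by rw [hEB1, mul_one]
  have hNDle : ND ≤ BD * s + BD * (2 * α * (1 + Real.exp (4 * δ)) * (C₁ * ND))
      + (C₃ * (6 * α * (1 + Real.exp (4 * δ)) * (NV + C₂ * ND)) + BD * (2 * α * (1 + Real.exp (4 * δ)) * (C₁ * (C₃ * (6 * α * (1 + Real.exp (4 * δ)) * (NV + C₂ * ND))))))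
      + BD * (CT * (NV + C₂ * ND)) + (C₃ * (CTD * (NV + C₂ * ND)) + BD * (2 * α * (1 + Real.exp (4 * δ)) * (C₁ * (C₃ * (CTD * (NV + C₂ * ND)))))) := by
    have e1 : ‖V x₀‖ ≤ (BD * s + BD * (2 * α * (1 + Real.exp (4 * δ)) * (C₁ * ND))
        + (C₃ * (6 * α * (1 + Real.exp (4 * δ)) * (NV + C₂ * ND)) + BD * (2 * α * (1 + Real.exp (4 * δ)) * (C₁ * (C₃ * (6 * α * (1 + Real.exp (4 * δ)) * (NV + C₂ * ND))))))
        + BD * (CT * (NV + C₂ * ND)) + (C₃ * (CTD * (NV + C₂ * ND)) + BD * (2 * α * (1 + Real.exp (4 * δ)) * (C₁ * (C₃ * (CTD * (NV + C₂ * ND)))))))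
          * Real.exp (-(δ * (Site.tdist (iterBlockOf (K - n) x₀) z : ℝ))) :=
      hasm.2.trans (le_of_eq (by ring))
    calc ND = wS x₀ * ‖V x₀‖ := hNDd
      _ ≤ wS x₀ * ((BD * s + BD * (2 * α * (1 + Real.exp (4 * δ)) * (C₁ * ND))
        + (C₃ * (6 * α * (1 + Real.exp (4 * δ)) * (NV + C₂ * ND)) + BD * (2 * α * (1 + Real.exp (4 * δ)) * (C₁ * (C₃ * (6 * α * (1 + Real.exp (4 * δ)) * (NV + C₂ * ND))))))
        + BD * (CT * (NV + C₂ * ND)) + (C₃ * (CTD * (NV + C₂ * ND)) + BD * (2 * α * (1 + Real.exp (4 * δ)) * (C₁ * (C₃ * (CTD * (NV + C₂ * ND)))))))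
          * Real.exp (-(δ * (Site.tdist (iterBlockOf (K - n) x₀) z : ℝ)))) := mul_le_mul_of_nonneg_left e1 (hwSpos x₀).le
      _ = (BD * s + BD * (2 * α * (1 + Real.exp (4 * δ)) * (C₁ * ND))
        + (C₃ * (6 * α * (1 + Real.exp (4 * δ)) * (NV + C₂ * ND)) + BD * (2 * α * (1 + Real.exp (4 * δ)) * (C₁ * (C₃ * (6 * α * (1 + Real.exp (4 * δ)) * (NV + C₂ * ND))))))
        + BD * (CT * (NV + C₂ * ND)) + (C₃ * (CTD * (NV + C₂ * ND)) + BD * (2 * α * (1 + Real.exp (4 * δ)) * (C₁ * (C₃ * (CTD * (NV + C₂ * ND)))))))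
          * (wS x₀ * Real.exp (-(δ * (Site.tdist (iterBlockOf (K - n) x₀) z : ℝ)))) := by ring
      _ = _ := by rw [hES1, mul_one]
  -- the fixpoint (FILE C's `bootstrap_two`), with an opaque name for `1 + e^{4δ}`
  obtain ⟨E4, hE4d⟩ : ∃ t : ℝ, t = 1 + Real.exp (4 * δ) := ⟨_, rfl⟩
  rw [← hE4d] at hNVle hNDle hwin
  have hE40 : 0 ≤ E4 := by rw [hE4d]; exact hE4
  have hfix : NV + ND ≤ 2 * (BV * s + BD * s) := by
    refine bootstrap_two (XV := NV) (XD := ND) (AV := BV * s) (AD := BD * s) (p := BV * (2 * α * E4 * C₁)) (p' := BD * (2 * α * E4 * C₁))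
      (q := 6 * α * E4 * C₃ * (C₂ + BV * (2 * α * E4 * C₁)) + BV * CT + C₃ * CTD * (C₂ + BV * (2 * α * E4 * C₁)))
      (q' := 6 * α * E4 * C₃ * (1 + BD * (2 * α * E4 * C₁)) + BD * CT + C₃ * CTD * (1 + BD * (2 * α * E4 * C₁))) (C₂ := C₂) (P := NV + C₂ * ND)
      hNV0 hND0 (by positivity) (by positivity) (by positivity) (by positivity) hC₂ le_rfl ?_ ?_ ?_
    · have : BV * s + BV * (2 * α * E4 * (C₁ * ND)) + (C₂ * (C₃ * (6 * α * E4 * (NV + C₂ * ND))) + BV * (2 * α * E4 * (C₁ * (C₃ * (6 * α * E4 * (NV + C₂ * ND))))))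
          + BV * (CT * (NV + C₂ * ND)) + (C₂ * (C₃ * (CTD * (NV + C₂ * ND))) + BV * (2 * α * E4 * (C₁ * (C₃ * (CTD * (NV + C₂ * ND))))))
          = BV * s + BV * (2 * α * E4 * C₁) * ND + (6 * α * E4 * C₃ * (C₂ + BV * (2 * α * E4 * C₁)) + BV * CT + C₃ * CTD * (C₂ + BV * (2 * α * E4 * C₁))) * (NV + C₂ * ND) := by ring
      linarith [hNVle, this]
    · have : BD * s + BD * (2 * α * E4 * (C₁ * ND)) + (C₃ * (6 * α * E4 * (NV + C₂ * ND)) + BD * (2 * α * E4 * (C₁ * (C₃ * (6 * α * E4 * (NV + C₂ * ND))))))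
          + BD * (CT * (NV + C₂ * ND)) + (C₃ * (CTD * (NV + C₂ * ND)) + BD * (2 * α * E4 * (C₁ * (C₃ * (CTD * (NV + C₂ * ND))))))
          = BD * s + BD * (2 * α * E4 * C₁) * ND + (6 * α * E4 * C₃ * (1 + BD * (2 * α * E4 * C₁)) + BD * CT + C₃ * CTD * (1 + BD * (2 * α * E4 * C₁))) * (NV + C₂ * ND) := by ring
      linarith [hNDle, this]
    · have : BV * (2 * α * E4 * C₁) + BD * (2 * α * E4 * C₁)
          + (6 * α * E4 * C₃ * (C₂ + BV * (2 * α * E4 * C₁)) + BV * CT + C₃ * CTD * (C₂ + BV * (2 * α * E4 * C₁))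
            + (6 * α * E4 * C₃ * (1 + BD * (2 * α * E4 * C₁)) + BD * CT + C₃ * CTD * (1 + BD * (2 * α * E4 * C₁)))) * (1 + C₂)
          = 2 * E4 * α * C₁ * (BV + BD) + ((6 * α * E4 + CTD) * C₃ * (1 + C₂ + 2 * E4 * α * C₁ * (BV + BD)) + CT * (BV + BD)) * (1 + C₂) := by ring
      linarith [hwin, this]
  have hNV' : NV ≤ 2 * (BV + BD) * s := by linarith
  have hND' : ND ≤ 2 * (BV + BD) * s := by linarith
  refine ⟨fun bd => ?_, fun x => ?_⟩
  · exact (hUb bd).trans (mul_le_mul_of_nonneg_right hNV' (Real.exp_pos _).le)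
  · exact (hVx x).trans (mul_le_mul_of_nonneg_right hND' (Real.exp_pos _).le)


end Bootstrap

end Summit.QuantumFields.YangMills.Theorems.Prop7GreenOneBlockDecayOfLetters

end
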